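import Literature.MathematicalPhysics.QuantumFieldTheory.YangMillsOS
import Literature.MathematicalPhysics.QuantumLattice.WilsonBlockHeatBathLightCone2

/-!
# Stub `stub_betaAbsorption` of line `Sketch` (one-form Witten / IMS) for crux stmt-QuantumFields-8761
(`Summit.QuantumFields.YangMills.Theses.EquipartitionCriticality.LatticeGapLargeBeta`)

Absorbing a β-dependent prefactor into the rate: per-β clustering with a β-independent weight ⇒ the
crux body with β-uniform constants.
-/

noncomputable section

open scoped BigOperators Topology
open MeasureTheory ProbabilityTheory Filter
open Literature.MathematicalPhysics.QuantumFieldTheory Literature.MathematicalPhysics.QuantumLattice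

namespace Summit.QuantumFields.YangMills.Theorems.LatticeGapLargeBeta.WittenIMS

/-- **Absorption of a β-dependent prefactor into the rate.** If `0 ≤ x ≤ D` and
`x ≤ K · D · e^{-m n}` with `K ≥ 1`, `m > 0`, then `x ≤ e · D · e^{-(m / max 1 (log K)) n}`:
a large prefactor `K` costs only a factor `max(1, log K)` in the rate and a factor `e` in the
constant. [folklore] -/
theorem le_exp_mul_exp_neg_div_of_le_of_le_mul_exp {x D K m n : ℝ}
    (hD : 0 ≤ D) (hx : x ≤ D) (hK : 1 ≤ K) (hm : 0 < m)
    (hxK : x ≤ K * D * Real.exp (-(m * n))) :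
    x ≤ Real.exp 1 * D * Real.exp (-(m / max 1 (Real.log K) * n)) := by
  set L := max 1 (Real.log K) with hL
  have hL1 : 1 ≤ L := le_max_left _ _
  have hLpos : 0 < L := lt_of_lt_of_le one_pos hL1
  have hlogK : Real.log K ≤ L := le_max_right _ _
  by_cases hcase : m * n ≤ L
  · -- e^{-(m/L) n} ≥ e^{-1}
    have h1 : Real.exp (-1) ≤ Real.exp (-(m / L * n)) := by
      apply Real.exp_le_exp.mpr
      rw [div_mul_eq_mul_div, neg_le_neg_iff, div_le_one hLpos]
      exact hcase
    calc x ≤ D := hx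
      _ = Real.exp 1 * D * Real.exp (-1) := by
          rw [mul_comm (Real.exp 1) D, mul_assoc, ← Real.exp_add]; simp
      _ ≤ Real.exp 1 * D * Real.exp (-(m / L * n)) := by
          apply mul_le_mul_of_nonneg_left h1
          exact mul_nonneg (Real.exp_pos 1).le hD
  · have hcase : L < m * n := lt_of_not_ge hcase
    -- x ≤ K D e^{-mn} = D e^{log K - m n} ≤ e D e^{-mn/L}
    have hKpos : 0 < K := lt_of_lt_of_le one_pos hK
    have h2 : Real.log K - m * n ≤ 1 - m / L * n := by
      -- log K - 1 ≤ m n (1 - 1/L); since m n > L ≥ 1: m n (1 - 1/L) = m n - m n / L > L - 1·(m n)/L ... 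
      have h3 : m / L * n = m * n / L := by ring
      rw [h3]
      have h4 : m * n / L * (L - 1) ≥ (L - 1) := by
        have : m * n / L ≥ 1 := by rw [ge_iff_le, le_div_iff₀ hLpos]; linarith
        nlinarith
      have h5 : m * n - m * n / L = m * n / L * (L - 1) := by field_simp
      linarith
    calc x ≤ K * D * Real.exp (-(m * n)) := hxK
      _ = D * Real.exp (Real.log K - m * n) := by
          rw [Real.exp_sub, Real.exp_log hKpos, Real.exp_neg]; field_simp
      _ ≤ D * Real.exp (1 - m / L * n) := by
          apply mul_le_mul_of_nonneg_left (Real.exp_le_exp.mpr h2) hD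
      _ = Real.exp 1 * D * Real.exp (-(m / L * n)) := by
          rw [sub_eq_add_neg, Real.exp_add]; ring

/-- `stub_betaAbsorption` — **absorbing the β-dependent prefactor into the rate** (P3; provable now,
size S).  Per-`β` clustering `|corr| ≤ K(β) D(A,B) e^{−m(β) n}` with a `β`-independent weight `D`, together
with the a priori bound `|corr| ≤ 2 C_A C_B` (`abs_latticeConnectedCorr_le_two_mul`), gives the crux's form
with the `β`-UNIFORM constant `C(A,B) = e · max(D(A,B), 2 C_A C_B)` and the rate
`m(β) / max(1, log K″(β))`, `K″ = max(K, 1)`: if `0 ≤ x ≤ D'` and `x ≤ K″ D' e^{−mn}` then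
`x ≤ e D' e^{−mn/max(1, log K″)}` (two cases `mn ≤ / > max(1, log K″)`). -/
theorem stub_betaAbsorption :
    ∀ (G : Type) [Group G] [TopologicalSpace G] [IsTopologicalGroup G] [CompactSpace G]
      [MeasurableSpace G] [BorelSpace G] (r : LatticeRep G),
    (∃ D : YMSpecies G → YMSpecies G → ℝ, ∃ β₁ : ℝ, ∀ β : ℝ, β₁ ≤ β →
      ∃ m : ℝ, 0 < m ∧ ∃ K : ℝ, ∃ S₁ : ℕ, ∀ (A B : YMSpecies G) (S n : ℕ), S₁ ≤ S → n ≤ S →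
        |latticeConnectedCorr r.ρ β (2 * S + 1) A.F B.F n| ≤ K * D A B * Real.exp (-(m * n))) →
    ∃ (β₁ : ℝ) (m : ℝ → ℝ) (S₀ : ℝ → ℕ), (∀ β : ℝ, β₁ ≤ β → 0 < m β) ∧
      ∀ A B : YMSpecies G, ∃ C : ℝ, ∀ β : ℝ, β₁ ≤ β → ∀ S n : ℕ, S₀ β ≤ S → n ≤ S →
        |latticeConnectedCorr r.ρ β (2 * S + 1) A.F B.F n| ≤ C * Real.exp (-(m β * n)) := by
  intro G _ _ _ _ _ _ r hyp
  obtain ⟨D, β₁, hyp⟩ := hyp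
  choose! m hm hrest using hyp
  choose! K S₁ hK using hrest
  refine ⟨β₁, fun β => m β / max 1 (Real.log (max |K β| 1)), S₁, fun β hβ => ?_, fun A B => ?_⟩
  · exact div_pos (hm β hβ) (lt_of_lt_of_le one_pos (le_max_left _ _))
  · obtain ⟨CA, hCA⟩ := A.bounded
    obtain ⟨CB, hCB⟩ := B.bounded
    refine ⟨Real.exp 1 * max |D A B| (2 * (CA * CB)), fun β hβ S n hS hn => ?_⟩
    have hD' : 0 ≤ max |D A B| (2 * (CA * CB)) := le_trans (abs_nonneg _) (le_max_left _ _)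
    have hx : |latticeConnectedCorr r.ρ β (2 * S + 1) A.F B.F n| ≤ max |D A B| (2 * (CA * CB)) :=
      (WilsonBlockHeatBath.abs_latticeConnectedCorr_le_two_mul r β (2 * S + 1) hCA hCB n).trans
        (le_max_right _ _)
    have hK1 : (1 : ℝ) ≤ max |K β| 1 := le_max_right _ _
    have hxK : |latticeConnectedCorr r.ρ β (2 * S + 1) A.F B.F n| ≤
        max |K β| 1 * max |D A B| (2 * (CA * CB)) * Real.exp (-(m β * n)) := by
      refine (hK β hβ A B S n hS hn).trans ?_
      refine mul_le_mul_of_nonneg_right ?_ (Real.exp_pos _).le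
      calc K β * D A B ≤ |K β * D A B| := le_abs_self _
        _ = |K β| * |D A B| := abs_mul _ _
        _ ≤ max |K β| 1 * max |D A B| (2 * (CA * CB)) :=
          mul_le_mul (le_max_left _ _) (le_max_left _ _) (abs_nonneg _)
            ((abs_nonneg _).trans (le_max_left _ _))
    exact le_exp_mul_exp_neg_div_of_le_of_le_mul_exp hD' hx hK1 (hm β hβ) hxK

end Summit.QuantumFields.YangMills.Theorems.LatticeGapLargeBeta.WittenIMS

end
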